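import Mathlib.Combinatorics.Enumerative.DoubleCounting
import Summits.MatrixMultiplication.MatrixMultiplication.Theorems.SoloInformedNearRectPins

/-!
# THEOREM 8.19 (core): a pinned triple near-rectangle obeys the exception-calculus bound

This work, §8.8 (T12)(f) and C3-m2 §5.5 (gen 107). Setting: a CU13-Def-12 realization of `⟨n,n,n⟩` in
`𝒮(S⁰ × S¹, ±)` [CohnUmans2013, arXiv:1207.6528, Def. 12] — equation data `D : Data ι G` (no 2-torsion `hG`),
a chart `Φ`, full separation.

THE NEAR-RECTANGLE: `a ≈ [v′]` on `I₀ × 𝓛` (each row and each column has `≤ e` exceptional cells) and `b ≈ [v]`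
on `𝓛 × K₁` (same), generic classes `v, v′, v + v′ ≠ 0`.
* `Data.c_row_pinned` — THE PIN: a `b`-deviation `b(j_d,k) ≁ v` (`j_d ∈ 𝓛`) pins row `k` of `c` to ONE of the
  classes `[v′+v]`, `[v′−v]` on all rows `i ∈ I₀` conforming at `j_d`.
* `Data.nearRect_core` — if every `k ∈ K₁` is pinned to `[v′+v]` (deviation row `jd k ∈ 𝓛`), then, with
  `I₁ := {i ∈ I₀ : row i of a is 2-classed (v′ ∣ v′+2v) on 𝓛}`: `|I₀ ∖ I₁| ≤ 2e` and the box `I₁ × 𝓛 × K₁` is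
  2-classed with the exception table of `SoloInformedNearRectPins`, whence by THEOREM 8.18
  (`Data.card_unstarred_le`): `|I₁|·|𝓛|·|K₁| ≤ |S⁰| + e·|𝓛|·|K₁| + e·|𝓛|·|I₁| + e·|K₁|·|𝓛|`.
The other pinned half (`[v′−v]`) is the same statement with `v ↦ −v`; the un-pinned (clean) columns are handled by
(T2a). No counting of fibres, no chart hypothesis beyond separation.
-/

namespace Summit.MatrixMultiplication.MatrixMultiplication.Theorems.TwistedTPP

namespace FibreLines

variable {ι G : Type*} [AddCommGroup G]

/-- Conforming cells exist: row `i` of `a` and column `k` of `b` each miss `≤ e` of the `> 2e` lines `𝓛`. -/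
theorem Data.exists_conforming [DecidableEq ι] (D : Data ι G) {v v' : G} (L : Finset ι) (e : ℕ) {i k : ι}
    (har : ∃ E : Finset ι, E.card ≤ e ∧ ∀ j ∈ L, j ∉ E → SignEq (D.a i j) v')
    (hbc : ∃ E : Finset ι, E.card ≤ e ∧ ∀ j ∈ L, j ∉ E → SignEq (D.b j k) v) (hL : 2 * e < L.card) :
    ∃ j ∈ L, SignEq (D.a i j) v' ∧ SignEq (D.b j k) v := by
  obtain ⟨E₁, hE₁, h₁⟩ := har
  obtain ⟨E₂, hE₂, h₂⟩ := hbc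
  obtain ⟨j, hj, hjE⟩ := Finset.exists_mem_notMem_of_card_lt_card (s := E₁ ∪ E₂) (t := L)
    (by have := Finset.card_union_le E₁ E₂; omega)
  rw [Finset.mem_union, not_or] at hjE
  exact ⟨j, hj, h₁ j hj hjE.1, h₂ j hj hjE.2⟩

/-- **The pin (step (2) of THEOREM 8.19).** A `b`-deviation `b(j_d,k) ≁ v` with `j_d ∈ 𝓛` pins row `k` of `c`
to ONE class, `[v′+v]` or `[v′−v]`, on every row `i ∈ I₀` conforming at `j_d`. [this work, §8.8 (T12)(f)] -/
theorem Data.c_row_pinned [DecidableEq ι] (hG : ∀ x : G, x = -x → x = 0) (D : Data ι G) {v v' : G}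
    (I₀ L : Finset ι) (e : ℕ) {k jd : ι} (hdev : ¬ SignEq v (D.b jd k))
    (har : ∀ i ∈ I₀, ∃ E : Finset ι, E.card ≤ e ∧ ∀ j ∈ L, j ∉ E → SignEq (D.a i j) v')
    (hbk : ∃ E : Finset ι, E.card ≤ e ∧ ∀ j ∈ L, j ∉ E → SignEq (D.b j k) v) (hL : 2 * e < L.card) :
    (∀ i ∈ I₀, SignEq (D.a i jd) v' → SignEq (D.c k i) (v' + v)) ∨
      (∀ i ∈ I₀, SignEq (D.a i jd) v' → SignEq (D.c k i) (v' - v)) := by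
  by_cases h : ∃ i₀ ∈ I₀, SignEq (D.a i₀ jd) v' ∧ SignEq (D.c k i₀) (v' + v)
  · left
    obtain ⟨i₀, hi₀, ha₀, hc₀⟩ := h
    obtain ⟨j₀, -, ha₀', hb₀⟩ := D.exists_conforming L e (har i₀ hi₀) hbk hL
    intro i hi hai
    obtain ⟨j₁, -, ha₁, hb₁⟩ := D.exists_conforming L e (har i hi) hbk hL
    exact (D.c_signEq_c_of_b_dev hG hdev hai ha₀ ha₁ hb₁ ha₀' hb₀).trans hc₀
  · right
    push Not at h
    intro i hi hai
    obtain ⟨j₁, -, ha₁, hb₁⟩ := D.exists_conforming L e (har i hi) hbk hL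
    exact c_class_of_dev (D.adm_eqn i j₁ k) ha₁ hb₁ (h i hi hai)

variable {G₀ : Type*} [AddCommGroup G₀]

/-- **THEOREM 8.19 (core, every chart): a triple near-rectangle pinned to `[v′+v]` obeys the exception-calculus
bound.** [this work, §8.8 (T12)(f) steps (5)–(6); C3-m2 §5.5] -/
theorem Data.nearRect_core [Fintype G₀] [DecidableEq G₀] [DecidableEq ι] [DecidableEq G]
    (hG : ∀ x : G, x = -x → x = 0) (D : Data ι G) (Φ : Chart ι G₀) (hsep : D.SepAll Φ) {v v' : G}
    (hv : v ≠ 0) (hv' : v' ≠ 0) (hs : v + v' ≠ 0) (I₀ L K₁ : Finset ι) (e : ℕ) (jd : ι → ι)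
    (hjd : ∀ k ∈ K₁, jd k ∈ L)
    (hac : ∀ j ∈ L, ∃ E : Finset ι, E.card ≤ e ∧ ∀ i ∈ I₀, i ∉ E → SignEq (D.a i j) v')
    (har : ∀ i ∈ I₀, ∃ E : Finset ι, E.card ≤ e ∧ ∀ j ∈ L, j ∉ E → SignEq (D.a i j) v')
    (hbr : ∀ j ∈ L, ∃ E : Finset ι, E.card ≤ e ∧ ∀ k ∈ K₁, k ∉ E → SignEq (D.b j k) v)
    (hbc : ∀ k ∈ K₁, ∃ E : Finset ι, E.card ≤ e ∧ ∀ j ∈ L, j ∉ E → SignEq (D.b j k) v)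
    (hpin : ∀ k ∈ K₁, ∀ i ∈ I₀, SignEq (D.a i (jd k)) v' → SignEq (D.c k i) (v' + v))
    (hL : 2 * e < L.card) (hK : 2 * e < K₁.card) :
    ∃ I₁ ⊆ I₀, I₀.card ≤ I₁.card + 2 * e ∧
      I₁.card * L.card * K₁.card ≤
        Fintype.card G₀ + e * (L.card * K₁.card) + e * (L.card * I₁.card) + e * (K₁.card * L.card) := by
  classical
  -- `c` is 2-classed on `K₁ × I₀`
  have hc2 : ∀ k ∈ K₁, ∀ i ∈ I₀, SignEq (D.c k i) (v' + v) ∨ SignEq (D.c k i) (v' - v) := by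
    intro k hk i hi
    obtain ⟨j, -, ha, hb⟩ := D.exists_conforming L e (har i hi) (hbc k hk) hL
    exact signEq_or_of_conforming (D.adm_eqn i j k) ha hb
  -- the 2-classed rows
  set I₁ : Finset ι := I₀.filter fun i => ∀ j ∈ L, SignEq (D.a i j) v' ∨ SignEq (D.a i j) (v' + v + v)
    with hI₁
  have hI₁sub : I₁ ⊆ I₀ := Finset.filter_subset _ _
  have ha2 : ∀ i ∈ I₁, ∀ j ∈ L, SignEq (D.a i j) v' ∨ SignEq (D.a i j) (v' + v + v) := fun i hi =>
    (Finset.mem_filter.1 hi).2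
  refine ⟨I₁, hI₁sub, ?_, ?_⟩
  · -- bad rows: every `k ∈ K₁` off `≤ e` sees an `a`-deviation at `(i, jd k)`; double count
    set Ib : Finset ι := I₀.filter fun i => ¬ ∀ j ∈ L, SignEq (D.a i j) v' ∨ SignEq (D.a i j) (v' + v + v)
      with hIb
    have hsplit : I₁.card + Ib.card = I₀.card := Finset.card_filter_add_card_filter_not _
    have hcount : Ib.card • (K₁.card - e) ≤ K₁.card • e := by
      refine Finset.card_nsmul_le_card_nsmul (r := fun i k => ¬ SignEq (D.a i (jd k)) v') ?_ ?_
      · intro i hi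
        obtain ⟨hi₀, hbad⟩ := Finset.mem_filter.1 hi
        push Not at hbad
        obtain ⟨j, hj, hn₁, hn₂⟩ := hbad
        obtain ⟨E, hE, hEb⟩ := hbr j hj
        have hsub : K₁ \ E ⊆ K₁.bipartiteAbove (fun i k => ¬ SignEq (D.a i (jd k)) v') i := by
          intro k hk
          rw [Finset.mem_sdiff] at hk
          rw [Finset.mem_bipartiteAbove]
          refine ⟨hk.1, fun hak => ?_⟩
          rcases a_classes_of_dev (D.adm_eqn i j k) (hEb k hk.1 hk.2) (hpin k hk.1 i hi₀ hak) with h | h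
          · exact hn₁ h
          · exact hn₂ h
        have h2 : K₁.card ≤ (K₁ \ E).card + E.card := Finset.card_le_card_sdiff_add_card
        exact le_trans (by omega) (Finset.card_le_card hsub)
      · intro k hk
        obtain ⟨E, hE, hEa⟩ := hac (jd k) (hjd k hk)
        have hsub : Ib.bipartiteBelow (fun i k => ¬ SignEq (D.a i (jd k)) v') k ⊆ E := by
          intro i hi
          rw [Finset.mem_bipartiteBelow] at hi
          obtain ⟨hiI, hno⟩ := hi
          by_contra hiE
          exact hno (hEa i (Finset.mem_filter.1 hiI).1 hiE)
        exact (Finset.card_le_card hsub).trans hE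
    rw [smul_eq_mul, smul_eq_mul] at hcount
    have hIb2 : Ib.card ≤ 2 * e := by
      by_contra hc
      push Not at hc
      obtain ⟨m, hm⟩ : ∃ m, K₁.card = m + e := ⟨K₁.card - e, by omega⟩
      rw [hm, Nat.add_sub_cancel] at hcount
      have hme : e < m := by omega
      nlinarith
    omega
  · by_cases hIbig : 2 * e < I₁.card
    · -- `b` is 2-classed on `𝓛 × K₁`
      have hb2 : ∀ j ∈ L, ∀ k ∈ K₁, SignEq (D.b j k) v ∨ SignEq (D.b j k) (v + v' + v') := by
        intro j hj k hk
        obtain ⟨E₁, hE₁, h₁⟩ := hac j hj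
        obtain ⟨E₂, hE₂, h₂⟩ := hac (jd k) (hjd k hk)
        obtain ⟨i, hi, hiE⟩ := Finset.exists_mem_notMem_of_card_lt_card (s := E₁ ∪ E₂) (t := I₁)
          (by have := Finset.card_union_le E₁ E₂; omega)
        rw [Finset.mem_union, not_or] at hiE
        have hi₀ := hI₁sub hi
        exact b_classes_of_dev (D.adm_eqn i j k) (h₁ i hi₀ hiE.1) (hpin k hk i hi₀ (h₂ i hi₀ hiE.2))
      -- THEOREM 8.18
      have hU := D.card_unstarred_le Φ hsep (table_t0 v v') (table_ta v v') (table_tb v v') (table_tc v v')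
        (table_nab hG hv hv' hs) (table_nac hG hv hv' hs) (table_nbc hG hv hv' hs) I₁ L K₁ ha2 hb2
        (fun k hk i hi => hc2 k hk i (hI₁sub hi))
      -- the starred triples
      set box := I₁ ×ˢ L ×ˢ K₁ with hbox
      have hboxcard : box.card = I₁.card * (L.card * K₁.card) := by
        rw [hbox, Finset.card_product, Finset.card_product]
      have hsplit : (box.filter fun t : ι × ι × ι =>
          (D.a t.1 t.2.1 = v' ∨ D.a t.1 t.2.1 = -v') ∧ (D.b t.2.1 t.2.2 = v ∨ D.b t.2.1 t.2.2 = -v) ∧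
            (D.c t.2.2 t.1 = v' + v ∨ D.c t.2.2 t.1 = -(v' + v))).card +
          (box.filter fun t : ι × ι × ι => ¬ ((D.a t.1 t.2.1 = v' ∨ D.a t.1 t.2.1 = -v') ∧
            (D.b t.2.1 t.2.2 = v ∨ D.b t.2.1 t.2.2 = -v) ∧
              (D.c t.2.2 t.1 = v' + v ∨ D.c t.2.2 t.1 = -(v' + v)))).card = box.card :=
        Finset.card_filter_add_card_filter_not _
      set A := L.biUnion fun j => (I₁.filter fun i => ¬ SignEq (D.a i j) v') ×ˢ ({j} ×ˢ K₁) with hA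
      set B := L.biUnion fun j => I₁ ×ˢ ({j} ×ˢ (K₁.filter fun k => ¬ SignEq (D.b j k) v)) with hB
      set C := K₁.biUnion fun k => (I₁.filter fun i => ¬ SignEq (D.c k i) (v' + v)) ×ˢ (L ×ˢ {k})
        with hC
      have hbad : (box.filter fun t : ι × ι × ι => ¬ ((D.a t.1 t.2.1 = v' ∨ D.a t.1 t.2.1 = -v') ∧
            (D.b t.2.1 t.2.2 = v ∨ D.b t.2.1 t.2.2 = -v) ∧
              (D.c t.2.2 t.1 = v' + v ∨ D.c t.2.2 t.1 = -(v' + v)))) ⊆ A ∪ B ∪ C := by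
        intro t ht
        rw [Finset.mem_filter] at ht
        obtain ⟨htb, htg⟩ := ht
        rw [hbox, Finset.mem_product, Finset.mem_product] at htb
        obtain ⟨hti, htj, htk⟩ := htb
        rw [Finset.mem_union, Finset.mem_union]
        by_cases h1 : SignEq (D.a t.1 t.2.1) v'
        · by_cases h2 : SignEq (D.b t.2.1 t.2.2) v
          · have h3 : ¬ SignEq (D.c t.2.2 t.1) (v' + v) := fun h3 => htg ⟨h1, h2, h3⟩
            right
            rw [hC, Finset.mem_biUnion]
            refine ⟨t.2.2, htk, ?_⟩
            simp only [Finset.mem_product, Finset.mem_singleton]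
            exact ⟨Finset.mem_filter.2 ⟨hti, h3⟩, htj, trivial⟩
          · left; right
            rw [hB, Finset.mem_biUnion]
            refine ⟨t.2.1, htj, ?_⟩
            simp only [Finset.mem_product, Finset.mem_singleton]
            exact ⟨hti, trivial, Finset.mem_filter.2 ⟨htk, h2⟩⟩
        · left; left
          rw [hA, Finset.mem_biUnion]
          refine ⟨t.2.1, htj, ?_⟩
          simp only [Finset.mem_product, Finset.mem_singleton]
          exact ⟨Finset.mem_filter.2 ⟨hti, h1⟩, trivial, htk⟩
      have hAc : A.card ≤ L.card * (e * K₁.card) := by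
        refine (Finset.card_biUnion_le).trans ((Finset.sum_le_card_nsmul _ _ _ fun j hj => ?_).trans
          (by rw [smul_eq_mul]))
        obtain ⟨E, hE, hEa⟩ := hac j hj
        have hsub : (I₁.filter fun i => ¬ SignEq (D.a i j) v') ⊆ E := by
          intro i hi
          rw [Finset.mem_filter] at hi
          by_contra hiE
          exact hi.2 (hEa i (hI₁sub hi.1) hiE)
        rw [Finset.card_product, Finset.card_product, Finset.card_singleton, one_mul]
        exact Nat.mul_le_mul_right _ ((Finset.card_le_card hsub).trans hE)
      have hBc : B.card ≤ L.card * (I₁.card * e) := by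
        refine (Finset.card_biUnion_le).trans ((Finset.sum_le_card_nsmul _ _ _ fun j hj => ?_).trans
          (by rw [smul_eq_mul]))
        obtain ⟨E, hE, hEb⟩ := hbr j hj
        have hsub : (K₁.filter fun k => ¬ SignEq (D.b j k) v) ⊆ E := by
          intro k hk
          rw [Finset.mem_filter] at hk
          by_contra hkE
          exact hk.2 (hEb k hk.1 hkE)
        rw [Finset.card_product, Finset.card_product, Finset.card_singleton, one_mul]
        exact Nat.mul_le_mul_left _ ((Finset.card_le_card hsub).trans hE)
      have hCc : C.card ≤ K₁.card * (e * L.card) := by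
        refine (Finset.card_biUnion_le).trans ((Finset.sum_le_card_nsmul _ _ _ fun k hk => ?_).trans
          (by rw [smul_eq_mul]))
        obtain ⟨E, hE, hEa⟩ := hac (jd k) (hjd k hk)
        have hsub : (I₁.filter fun i => ¬ SignEq (D.c k i) (v' + v)) ⊆ E := by
          intro i hi
          rw [Finset.mem_filter] at hi
          by_contra hiE
          exact hi.2 (hpin k hk i (hI₁sub hi.1) (hEa i (hI₁sub hi.1) hiE))
        rw [Finset.card_product, Finset.card_product, Finset.card_singleton, mul_one]
        exact Nat.mul_le_mul_right _ ((Finset.card_le_card hsub).trans hE)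
      have hbadc := (Finset.card_le_card hbad).trans
          ((Finset.card_union_le _ _).trans (Nat.add_le_add_right (Finset.card_union_le _ _) _))
      have hmain : I₁.card * (L.card * K₁.card) ≤
          Fintype.card G₀ + L.card * (e * K₁.card) + L.card * (I₁.card * e) + K₁.card * (e * L.card) := by
        rw [← hboxcard, ← hsplit]; omega
      calc I₁.card * L.card * K₁.card = I₁.card * (L.card * K₁.card) := by ring
        _ ≤ _ := hmain
        _ = _ := by ring
    · push Not at hIbig
      have h1 : I₁.card * L.card * K₁.card ≤ 2 * e * L.card * K₁.card :=
        Nat.mul_le_mul_right _ (Nat.mul_le_mul_right _ hIbig)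
      have h2 : 2 * e * L.card * K₁.card = e * (L.card * K₁.card) + e * (K₁.card * L.card) := by ring
      omega

end FibreLines

end Summit.MatrixMultiplication.MatrixMultiplication.Theorems.TwistedTPP
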